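/- Fleet lead `ym-wcr-19456-p1`, route `WeakCouplingRates`, crux `ColdBoxTwoPointFloor` (stmt-QuantumFields-19456). -/
import Mathlib.Probability.ConditionalProbability
import Mathlib.MeasureTheory.Integral.Bochner.Set
import HarnessLib

/-!
# Crux `ColdBoxTwoPointFloor`, piece S3c-ii bookkeeping: conditioning on a likely (small-field) event moves bounded
# expectations by `≤ 2‖X‖∞·μ(bad)` and connected two-point functions by `≤ 6‖f‖∞‖g‖∞·μ(bad)`

The measure-theoretic step that converts S3c-i (`boxState_largeField_rarity`: large fields have probability `≤ e^{−β^ε}`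
in the cold box) into «restrict the box state to the small-field event» inside the load-bearing stub
`stub_boxDirichletDomination`/`stub_boxGaussianDomination`: for a probability measure `μ`, a measurable event `G` of positive
mass and bounded observables,
* `integral_cond_eq` — `∫ X dμ[·|G] = μ(G)⁻¹ ∫_G X dμ`;
* `abs_integral_sub_integral_cond_le` — `|∫ X dμ − ∫ X dμ[·|G]| ≤ 2·M·μ(Gᶜ)` if `|X| ≤ M`;
* `abs_cov_sub_cov_cond_le` — `|Cov_μ(f,g) − Cov_{μ[·|G]}(f,g)| ≤ 6·M_f·M_g·μ(Gᶜ)` (Cov written as `∫fg − ∫f∫g`, the form of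
  `boxPlaqCov`), if `|f| ≤ M_f`, `|g| ≤ M_g`.
With `f = g ∈ β·[0, 4]` (the `SU(2)` plaquette costs times `β`) and `μ(Gᶜ) ≤ e^{−β^ε}` the change is `≤ 96β²e^{−β^ε}`, negligible
against the signal `(3/2)Π² ≍ β^{−8A}` for every `A`.  Elementary; everything proved; no definition; standard axioms.
-/

set_option autoImplicit false

noncomputable section

open MeasureTheory ProbabilityTheory

namespace Summit.QuantumFields.YangMills.Theorems.WeakCouplingRates

variable {Ω : Type*} [MeasurableSpace Ω] {μ : Measure Ω} [IsProbabilityMeasure μ] {G : Set Ω}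

omit [IsProbabilityMeasure μ] in
/-- The conditional expectation given the good event, as a normalised set integral. -/
theorem integral_cond_eq (G : Set Ω) (X : Ω → ℝ) :
    ∫ ω, X ω ∂(μ[|G]) = (μ.real G)⁻¹ * ∫ ω in G, X ω ∂μ := by
  rw [ProbabilityTheory.cond, integral_smul_measure, ENNReal.toReal_inv, measureReal_def, smul_eq_mul]

/-- **Conditioning on a likely event moves a bounded expectation by at most `2·‖X‖∞·μ(bad)`.** -/
theorem abs_integral_sub_integral_cond_le (hG : MeasurableSet G) (hG0 : μ G ≠ 0) {X : Ω → ℝ} (hX : Integrable X μ)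
    {M : ℝ} (hM : ∀ ω, |X ω| ≤ M) :
    |(∫ ω, X ω ∂μ) - ∫ ω, X ω ∂(μ[|G])| ≤ 2 * M * μ.real Gᶜ := by
  have hsplit := integral_add_compl hG hX
  set p : ℝ := μ.real G with hp
  set a : ℝ := ∫ ω in G, X ω ∂μ with ha
  set b : ℝ := ∫ ω in Gᶜ, X ω ∂μ with hb
  have hp0 : 0 < p := by
    rw [hp, measureReal_def]; exact ENNReal.toReal_pos hG0 (measure_ne_top _ _)
  have hp1 : p + μ.real Gᶜ = 1 := by
    rw [hp, measureReal_add_measureReal_compl hG, probReal_univ]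
  have hab : |a| ≤ M * p := by
    rw [ha, hp]
    calc |∫ ω in G, X ω ∂μ| ≤ ∫ ω in G, |X ω| ∂μ := abs_integral_le_integral_abs
      _ ≤ ∫ _ in G, M ∂μ := setIntegral_mono_on hX.abs.integrableOn (integrableOn_const) hG fun ω _ => hM ω
      _ = M * μ.real G := by rw [setIntegral_const, smul_eq_mul, mul_comm]
  have hbb : |b| ≤ M * μ.real Gᶜ := by
    rw [hb]
    calc |∫ ω in Gᶜ, X ω ∂μ| ≤ ∫ ω in Gᶜ, |X ω| ∂μ := abs_integral_le_integral_abs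
      _ ≤ ∫ _ in Gᶜ, M ∂μ := setIntegral_mono_on hX.abs.integrableOn (integrableOn_const) hG.compl fun ω _ => hM ω
      _ = M * μ.real Gᶜ := by rw [setIntegral_const, smul_eq_mul, mul_comm]
  rw [integral_cond_eq, ← hsplit]
  -- ∫X - a/p = a(1 - 1/p) + b = b - a·(μ Gᶜ)/p
  have hε1 : μ.real Gᶜ = 1 - p := by linarith [hp1]
  have key : a + b - p⁻¹ * a = b - a * (μ.real Gᶜ / p) := by
    rw [hε1]
    field_simp
    ring
  rw [key]
  have h1 : |a * (μ.real Gᶜ / p)| ≤ M * μ.real Gᶜ := by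
    rw [abs_mul, abs_of_nonneg (by positivity : 0 ≤ μ.real Gᶜ / p)]
    calc |a| * (μ.real Gᶜ / p) ≤ M * p * (μ.real Gᶜ / p) :=
          mul_le_mul_of_nonneg_right hab (by positivity)
      _ = M * μ.real Gᶜ := by field_simp
  calc |b - a * (μ.real Gᶜ / p)| ≤ |b| + |a * (μ.real Gᶜ / p)| := abs_sub _ _
    _ ≤ M * μ.real Gᶜ + M * μ.real Gᶜ := add_le_add hbb h1
    _ = 2 * M * μ.real Gᶜ := by ring

/-- **Conditioning on a likely event moves a bounded connected two-point function by at most `6·‖f‖∞‖g‖∞·μ(bad)`.** -/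
theorem abs_cov_sub_cov_cond_le (hG : MeasurableSet G) (hG0 : μ G ≠ 0) {f g : Ω → ℝ}
    (hf : Integrable f μ) (hg : Integrable g μ) (hfg : Integrable (fun ω => f ω * g ω) μ)
    {Mf Mg : ℝ} (hMf : ∀ ω, |f ω| ≤ Mf) (hMg : ∀ ω, |g ω| ≤ Mg) :
    |((∫ ω, f ω * g ω ∂μ) - (∫ ω, f ω ∂μ) * (∫ ω, g ω ∂μ)) -
        ((∫ ω, f ω * g ω ∂(μ[|G])) - (∫ ω, f ω ∂(μ[|G])) * (∫ ω, g ω ∂(μ[|G])))| ≤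
      6 * Mf * Mg * μ.real Gᶜ := by
  haveI : IsProbabilityMeasure (μ[|G]) := cond_isProbabilityMeasure hG0
  have hne : Nonempty Ω := by
    by_contra h
    rw [not_nonempty_iff] at h
    have h1 : μ (Set.univ : Set Ω) = 1 := measure_univ
    rw [Set.univ_eq_empty_iff.2 h, measure_empty] at h1
    exact zero_ne_one h1
  obtain ⟨ω₀⟩ := hne
  have hMf0 : 0 ≤ Mf := (abs_nonneg _).trans (hMf ω₀)
  have hMg0 : 0 ≤ Mg := (abs_nonneg _).trans (hMg ω₀)
  have e1 := abs_integral_sub_integral_cond_le hG hG0 hfg (M := Mf * Mg) fun ω => by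
    rw [abs_mul]; exact mul_le_mul (hMf ω) (hMg ω) (abs_nonneg _) hMf0
  have e2 := abs_integral_sub_integral_cond_le hG hG0 hf hMf
  have e3 := abs_integral_sub_integral_cond_le hG hG0 hg hMg
  -- bounds on the means
  have mf : |∫ ω, f ω ∂μ| ≤ Mf := by
    calc |∫ ω, f ω ∂μ| ≤ ∫ ω, |f ω| ∂μ := abs_integral_le_integral_abs
      _ ≤ ∫ _, Mf ∂μ := integral_mono hf.abs (integrable_const _) hMf
      _ = Mf := by simp
  have mg' : |∫ ω, g ω ∂(μ[|G])| ≤ Mg := by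
    calc |∫ ω, g ω ∂(μ[|G])| ≤ ∫ ω, |g ω| ∂(μ[|G]) := abs_integral_le_integral_abs
      _ ≤ ∫ _, Mg ∂(μ[|G]) := by
          refine integral_mono_of_nonneg (ae_of_all _ fun _ => abs_nonneg _) (integrable_const _)
            (ae_of_all _ hMg)
      _ = Mg := by simp
  set A := ∫ ω, f ω * g ω ∂μ; set A' := ∫ ω, f ω * g ω ∂(μ[|G])
  set B := ∫ ω, f ω ∂μ; set B' := ∫ ω, f ω ∂(μ[|G])
  set C := ∫ ω, g ω ∂μ; set C' := ∫ ω, g ω ∂(μ[|G])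
  set ε := μ.real Gᶜ
  have hε : 0 ≤ ε := measureReal_nonneg
  -- (A - BC) - (A' - B'C') = (A - A') - B (C - C') - C' (B - B')
  have halg : (A - B * C) - (A' - B' * C') = (A - A') - B * (C - C') - C' * (B - B') := by ring
  rw [halg]
  calc |(A - A') - B * (C - C') - C' * (B - B')|
      ≤ |A - A'| + |B * (C - C')| + |C' * (B - B')| := by
        have := abs_sub (A - A' - B * (C - C')) (C' * (B - B'))
        have := abs_sub (A - A') (B * (C - C'))
        linarith
    _ ≤ 2 * (Mf * Mg) * ε + Mf * (2 * Mg * ε) + Mg * (2 * Mf * ε) := by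
        have h2 : |B * (C - C')| ≤ Mf * (2 * Mg * ε) := by
          rw [abs_mul]; exact mul_le_mul mf e3 (abs_nonneg _) hMf0
        have h3 : |C' * (B - B')| ≤ Mg * (2 * Mf * ε) := by
          rw [abs_mul]; exact mul_le_mul mg' e2 (abs_nonneg _) hMg0
        exact add_le_add (add_le_add e1 h2) h3
    _ = 6 * Mf * Mg * ε := by ring

end Summit.QuantumFields.YangMills.Theorems.WeakCouplingRates

end
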